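import Summits.CriticalPhenomena.PercolationContinuityZ3.Theses.PercLoopDislocationCovers

/-!
Refutation of `PercLoopDislocationCovers.CoverIsCovering` (item stmt-CriticalPhenomena-6532).

**Repair 2026-08-16:** the route's rev-4 `restate` renamed the item's successor `CoverIsCoveringR`,
so the Theses file no longer declares `CoverIsCovering` and this module stopped building
("Unknown identifier"); the refuted constant is re-declared below (original name and definiens,
ledger signature of stmt-CriticalPhenomena-6532), theorem text and proof unchanged.

Witness (found on paper by refuters g0/g2, landed here): `s = 2` (so `s/2 = 1`), patch letter
`P = (0,0,0)`, base bond `x = (1,1,0) → x + e₁ = (1,2,0)` (it passes the patch test: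
`2 ∣ x₁ - 1 = 0`, `(x₀ - 1) % 2 = 0 < 1`, `x₂ % 2 = 0 < 1`).  The word update is
`w ↦ (if w.head? = some P then w.tail else P :: w)`, so BOTH sheets `((1,1,0), [])` and
`((1,1,0), [P, P])` are glued to `v₀ = ((1,2,0), [P])`.  Hence `Prod.fst` is not injective on the
`G_2`-neighbours of `v₀` and `Set.BijOn Prod.fst (N_{G_2}(v₀)) (N_{ℤ³}(v₀.1))` fails: the inlined
graph is not a covering of `ℤ³` (it is not the loop-dislocated `ℤ/2`-cover the thesis intends —
every patch carries an `ℕ`-indexed ladder of sheets glued crosswise).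
-/

namespace Summit.CriticalPhenomena.PercolationContinuityZ3.Theorems

open Literature.Probability.LatticeModels

/-- **Record of the replaced route item `CoverIsCovering`** = stmt-CriticalPhenomena-6532 (route
PercLoopDislocationCovers, support item up to rev 3; ledger signature verbatim; NOT a route item):
the route was repaired (rev 4, 2026-08-15T20:34Z) by `restate` with the NEW decl name
`CoverIsCoveringR`, after which the gate-written `Theses/PercLoopDislocationCovers.lean` stopped
declaring this constant while the refutation below — which closed the item `refuted` at
754796b272e2 and is indexed as negative knowledge under this name — still states `¬` it.
Re-declared here under its original fully-qualified name with its original definiens solely so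
that the refutation record keeps elaborating (Theorems files are append-only: the theorem's
statement text may not change). It is FALSE (`PercLoopDislocationCoversCoverIsCovering_refuted`):
the inlined graph `G_s` glues sheet `w` to both `tail w` and `P :: w`. -/
def _root_.Summit.CriticalPhenomena.PercolationContinuityZ3.Theses.PercLoopDislocationCovers.CoverIsCovering :
    Prop :=
  (fun G : ℕ → SimpleGraph (Literature.Probability.LatticeModels.Site 3 × List (ℤ × ℤ × ℤ)) =>
      ∀ s : ℕ, 2 ≤ s → ∀ v : Literature.Probability.LatticeModels.Site 3 × List (ℤ × ℤ × ℤ),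
        Set.BijOn Prod.fst ((G s).neighborSet v)
          ((Literature.Probability.LatticeModels.zdGraph 3).neighborSet v.1))
    (fun s : ℕ => SimpleGraph.fromRel
      (fun x y : Literature.Probability.LatticeModels.Site 3 × List (ℤ × ℤ × ℤ) =>
        (Literature.Probability.LatticeModels.zdGraph 3).Adj x.1 y.1 ∧ y.2 =
          (if y.1 = x.1 + (Pi.single 1 1 : Literature.Probability.LatticeModels.Site 3) ∧
                (s : ℤ) ∣ x.1 1 - (s / 2 : ℕ) ∧ (x.1 0 - (s / 2 : ℕ)) % (s : ℤ) < (s / 2 : ℕ) ∧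
                  x.1 2 % (s : ℤ) < (s / 2 : ℕ) then
              some ((x.1 0 - (s / 2 : ℕ)) / (s : ℤ), (x.1 1 - (s / 2 : ℕ)) / (s : ℤ), x.1 2 / (s : ℤ))
            else if x.1 = y.1 + (Pi.single 1 1 : Literature.Probability.LatticeModels.Site 3) ∧
                (s : ℤ) ∣ y.1 1 - (s / 2 : ℕ) ∧ (y.1 0 - (s / 2 : ℕ)) % (s : ℤ) < (s / 2 : ℕ) ∧
                  y.1 2 % (s : ℤ) < (s / 2 : ℕ) then
              some ((y.1 0 - (s / 2 : ℕ)) / (s : ℤ), (y.1 1 - (s / 2 : ℕ)) / (s : ℤ), y.1 2 / (s : ℤ))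
            else none).elim x.2 (fun P => if x.2.head? = some P then x.2.tail else P :: x.2)))

/-- Refutes `PercLoopDislocationCovers.CoverIsCovering` [refuted-substantive]: at `s = 2` the
vertex `v₀ = ((1,2,0), [(0,0,0)])` of the inlined graph `G_2` has the two distinct neighbours
`((1,1,0), [])` and `((1,1,0), [(0,0,0), (0,0,0)])` with the same projection `(1,1,0)`, so
`Prod.fst` is not a bijection from `N_{G_2}(v₀)` onto `N_{ℤ³}((1,2,0))`.  No cheap repair: the
word-update rule (toggle the head letter) glues sheet `w` to both `tail w` and `P :: w` at every
patch bond for every `s ≥ 2`, so the construction must be replaced (e.g. by a genuine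
`ℤ/2`-holonomy cover on reduced words), not patched by a side condition.
barrier-candidate: none (a construction defect, not a technique limit). [folklore] -/
theorem PercLoopDislocationCoversCoverIsCovering_refuted :
    ¬ Summit.CriticalPhenomena.PercolationContinuityZ3.Theses.PercLoopDislocationCovers.CoverIsCovering := by
  intro h
  classical
  have hb := h 2 (le_refl 2) ((![1, 2, 0] : Site 3), [((0 : ℤ), (0 : ℤ), (0 : ℤ))])
  have hinj := hb.injOn
  -- base adjacency (1,1,0) ~ (1,2,0) in ℤ³ and the patch test at x = (1,1,0), s = 2
  have hbase : (![1, 2, 0] : Site 3) = ![1, 1, 0] + Pi.single 1 1 := by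
    funext i; fin_cases i <;> simp
  have hadj : (zdGraph 3).Adj (![1, 1, 0] : Site 3) ![1, 2, 0] :=
    (zdGraph_adj_iff _ _).2 ⟨1, Or.inl hbase⟩
  have hdvd : ((2 : ℕ) : ℤ) ∣ (![1, 1, 0] : Site 3) 1 - ((2 / 2 : ℕ) : ℤ) := by decide
  have hm0 : ((![1, 1, 0] : Site 3) 0 - ((2 / 2 : ℕ) : ℤ)) % ((2 : ℕ) : ℤ) < ((2 / 2 : ℕ) : ℤ) := by decide
  have hm2 : (![1, 1, 0] : Site 3) 2 % ((2 : ℕ) : ℤ) < ((2 / 2 : ℕ) : ℤ) := by decide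
  have hne : (((![1, 1, 0] : Site 3), ([] : List (ℤ × ℤ × ℤ))) : Site 3 × List (ℤ × ℤ × ℤ))
      ≠ (![1, 1, 0], [((0 : ℤ), (0 : ℤ), (0 : ℤ)), ((0 : ℤ), (0 : ℤ), (0 : ℤ))]) := by
    simp
  refine hne (hinj ?_ ?_ rfl)
  · -- ((1,1,0), []) is a G_2-neighbour of v₀
    rw [SimpleGraph.mem_neighborSet, SimpleGraph.fromRel_adj]
    refine ⟨?_, Or.inr ⟨hadj, ?_⟩⟩
    · intro hEq
      have := congrArg (fun q : Site 3 × List (ℤ × ℤ × ℤ) => q.1 1) hEq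
      simp at this
    · dsimp only
      rw [if_pos ⟨hbase, hdvd, hm0, hm2⟩]
      simp
  · -- ((1,1,0), [P, P]) is a G_2-neighbour of v₀
    rw [SimpleGraph.mem_neighborSet, SimpleGraph.fromRel_adj]
    refine ⟨?_, Or.inr ⟨hadj, ?_⟩⟩
    · intro hEq
      have := congrArg (fun q : Site 3 × List (ℤ × ℤ × ℤ) => q.1 1) hEq
      simp at this
    · dsimp only
      rw [if_pos ⟨hbase, hdvd, hm0, hm2⟩]
      simp

end Summit.CriticalPhenomena.PercolationContinuityZ3.Theorems
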